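import Literature.IUT.HodgeArakelov.BadPrimeGaussianMonoidsGenuineRecordOrbitOfTranslates
import Literature.IUT.HodgeArakelov.BadPrimeGaussianMonoidsGenuineRecordInftyFamily

/-!
# [IUTchII] Cor 3.5 (ii) at the `∞`-level, genuine `θ_env` data: print's ROOT CONDITION `hroots` («some positive power
# coincides, up to torsion, with an element of `θ`», Prop 1.4 p. 27) DERIVED for the pointed-inversion PAIR action from the
# class-level [EtTh] Prop 1.4 inputs of Prop 2.2 (ii) (proof-only; row «COR35ii-HORB-GENUINE», sequel)

S. Mochizuki, *Inter-universal Teichmüller theory II*, kurims Dec-2020 manuscript, Prop 1.4 p. 27 («`∞θ(Π)` … elements … for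
which some [positive integer] multiple coincides, up to torsion, with an element of `θ(Π)`»), Prop 2.2 (ii) p. 66 («respectively,
`μ`-orbit `∞θ^ι(Π_v) ⊆ ∞θ(Π_v)`»; «the proof of [EtTh], Theorem 1.6, (iii)»), Cor 3.5 (ii) p. 95 (`∞Ψ^ι_env(M^Θ_*) ⥲ ∞Ψ_ξ(M^Θ_*)`),
Rmk 3.6.1 p. 101 [cite: Mochizuki2012, Prop 2.2 (ii) p.66]. Claim key `Mochizuki2012` DISPUTED (D-0012). PROOF-ONLY companion
(abc-iut cell, layer L6, seat abc-iut-w4-d004 gen 4; node **IUTchII:Cor3.5(ii)**, `∞`-level; file 3 of row «COR35ii-HORB-GENUINE»).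
NO definition, NO `Prop` fact, NO instance; consumed BY NAME: abc-iut-w5-d187's key step (the pattern of
`IotaInvariantTheta'.isOfFinAddOrder_iotaH1_sub_of_root`, here WITHOUT the packaged `IotaInvariantTheta'` datum), abc-iut-w4-d004
gen 2's `hroots_toRecord` route (p427094) and gen 3/4's genuine-record theorems, abc-iut-w5-d192's `htors_toRecord_family`.

WHY. abc-iut-w4-d004's `∞`-level capstone at the genuine data `pi_restriction_inftyThetaMonoid_upToTorsion_toRecord_of_mem_thetaEnv`
(p434744; Cor 3.5 (ii) at `∞Ψ^ι_env`, faithful torsion form, ANY inversion family) carries print's root condition `hroots`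
(«every `ϑ ∈ ∞θ^{i₀}_env` has a positive power in `M^×_TM · θ^ℕ`») as a binder; the existing derivation `hroots_toRecord` (p427094)
needs abc-iut-L6-t19's PACKAGED datum `Θ : IotaInvariantTheta' Dec` with `iota i₀ = Θ.iotaLim` — not instantiable at the genuine
setting. HERE `hroots` is derived for a GIVEN action, hence at the genuine `θ_env` data for the pair action `pairRhoLim C α β …`:
* §1 `EtaleThetaData.isOfFinAddOrder_sub_of_root_of_invariant` (any Prop 1.4 output `D`, compatible `ρ`/`e`, `hker`): if
  `x ∈ lim_J` is `e`-invariant up to torsion and `N • x ≡ toLim t` up to torsion, then `t` is `ρ`-invariant up to torsion —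
  [EtTh] Thm 1.6 (iii)'s mechanism read in the limit;
* §2 `ThetaEnvData.exists_torsion_mul_eq_pow_of_mem_toRecord_inftyThetaEnv_of_translates` / `hroots_toRecord_of_translates`
  (any `θ_env` datum `T`, record `T.toRecord act κ iota` with `iota i₀ = e`): every `ϑ ∈ ∞θ^{i₀}_env` satisfies `ϑ^N = τ·θ` with
  `τ` TORSION (`N > 0`) for any `θ ∈ θ^{i₀}_env`, from the translate inputs `hdesc`/`hrev`/`hfree` (file 1's
  `thetaIota_orbit_of_translates`) + `hker`; hence `hroots` given `htors` (`M^μ_TM ⊆ M^×_TM`);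
* §3 AT THE GENUINE DATA: `EtaleLevels.hroots_toRecord_pairRhoLim` — inputs (R1)(R2)(R3) of abc-iut-w4-d010's `prop22_ii'_model`,
  `hker`, and `htors` DISCHARGED by abc-iut-w5-d192's `htors_toRecord_family` (bijective `c`, `μ ⊆ O`); and the capstone
  **`pi_restriction_inftyThetaMonoid_upToTorsion_toRecord_pairRhoLim`** = [IUTchII] Cor 3.5 (ii) at `∞Ψ^ι_env(𝕄_*)` (faithful
  torsion form) at the genuine data with `hroots` DISCHARGED.
RESIDUAL of the `∞`-level clause after this file ⊆ {(R1)(R2)(R3), `hker`/`hfix`, `μ ⊆ O`, `O` `Π`-stable (`hO`), the augmentation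
datum `q`/`w`/`hsec` of the sections, model data} — print-shaped only. HONEST FRAMING: composition of landed theorems; nothing
disputed is asserted; no side is taken on [IUTchIII] Cor 3.12; typed ≠ proved ≠ endorsed.
-/

noncomputable section

namespace Literature.IUT.HodgeArakelov

universe u

/-! ### §1. [EtTh] Thm 1.6 (iii)'s mechanism in the limit, for a GIVEN action -/

namespace EtaleThetaData

variable {S : ThetaSetting.{u}} {P : TopGroup.{u}} (D : EtaleThetaData S P)

/-- **KEY STEP for a given action** ([IUTchII] Prop 2.2 (ii) p. 66 «the proof of [EtTh], Theorem 1.6, (iii)», read in `lim_J`):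
for additive automorphisms `ρ` of `H¹(Π_Ÿ(Π), (l·Δ_Θ)(Π))` and `e` of its limit compatible through `toLim` (`hcompat`), and
`Ker(H¹ → lim_J) ⊆ torsion` (`hker`): if `x ∈ lim_J` is `e`-invariant up to torsion and `N • x` coincides up to torsion with the
image of a class `t`, then `t` is `ρ`-invariant up to torsion. (abc-iut-w5-d187's `isOfFinAddOrder_iotaH1_sub_of_root` without
the packaged `IotaInvariantTheta'` datum.) [cite: Mochizuki2012, Prop 2.2 (ii) p.66] -/
theorem isOfFinAddOrder_sub_of_root_of_invariant (ρ : D.coh.H1 ⊤ ≃+ D.coh.H1 ⊤) (e : D.coh.lim ≃+ D.coh.lim)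
    (hcompat : ∀ x, D.coh.toLim ⊤ (ρ x) = e (D.coh.toLim ⊤ x))
    (hker : ∀ y : D.coh.H1 ⊤, D.coh.toLim ⊤ y = 0 → IsOfFinAddOrder y)
    {x : D.coh.lim} (hinv : IsOfFinAddOrder (e x - x)) {N : ℕ} {t : D.coh.H1 ⊤}
    (hroot : IsOfFinAddOrder (N • x - D.coh.toLim ⊤ t)) :
    IsOfFinAddOrder (ρ t - t) := by
  -- push the root relation through `e`
  have h1 : IsOfFinAddOrder (N • e x - e (D.coh.toLim ⊤ t)) := by
    have := e.toAddMonoidHom.isOfFinAddOrder hroot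
    simpa [map_sub, map_nsmul] using this
  have h2 : IsOfFinAddOrder (N • e x - N • x) := by
    rw [← smul_sub]
    exact hinv.nsmul
  -- `e(L t) − L t = −(N•e x − e(L t)) + (N•e x − N•x) + (N•x − L t)`
  have h3 : IsOfFinAddOrder (e (D.coh.toLim ⊤ t) - D.coh.toLim ⊤ t) := by
    have hsum := (h1.neg.add h2).add hroot
    have heq : -(N • e x - e (D.coh.toLim ⊤ t)) + (N • e x - N • x) + (N • x - D.coh.toLim ⊤ t) =
        e (D.coh.toLim ⊤ t) - D.coh.toLim ⊤ t := by abel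
    rwa [heq] at hsum
  rw [← hcompat, ← map_sub] at h3
  exact D.isOfFinAddOrder_of_toLim hker h3

end EtaleThetaData

/-! ### §2. `hroots` for a `θ_env` datum and a GIVEN action, from the translate inputs -/

namespace ThetaEnvData

open TemperedThetaMonoids

variable {S : ThetaSetting.{u}} {F : ModelFamily S} {Sys : MonoThetaProjSystem F} (T : ThetaEnvData Sys)
  (act : Sys.PiX →* MulAut (Multiplicative T.cohEnv.lim)) {M : Type u} [CommMonoid M]
  (κ : M →* Multiplicative T.cohEnv.lim) {Iota : Type u} (iota : Iota → (T.D.coh.lim ≃+ T.D.coh.lim))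

/-- An element of `θ^{i₀}_env` of the produced record comes from a class `t₀ ∈ θ(Π)` whose image in the limit is
`(iota i₀)`-invariant up to torsion: `θ = transportLim (toLim t₀)` (multiplicatively). [cite: Mochizuki2012, Prop 3.1 (i) p.87] -/
theorem exists_theta_of_mem_toRecord_thetaEnv {i₀ : Iota} {θ : Multiplicative T.cohEnv.lim}
    (hθ : θ ∈ (T.toRecord act κ iota).thetaEnv i₀) :
    ∃ t₀ ∈ T.D.theta, IsOfFinAddOrder (iota i₀ (T.D.coh.toLim ⊤ t₀) - T.D.coh.toLim ⊤ t₀) ∧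
      Multiplicative.toAdd θ = T.transportLim (T.D.coh.toLim ⊤ t₀) := by
  have h := (T.mem_envSet_iff (T.thetaIotaLim (iota i₀)) θ).mp hθ
  rw [T.mem_thetaIotaLim_iff] at h
  obtain ⟨⟨t₀, ht₀, ht₀eq⟩, hinv⟩ := h
  refine ⟨t₀, ht₀, ?_, ?_⟩
  · rwa [← ht₀eq] at hinv
  · rw [ht₀eq]
    exact (T.transportLim.apply_symm_apply _).symm

/-- **[IUTchII] Prop 1.4 / Prop 2.2 (ii) for the produced record and a GIVEN action**: if `iota i₀ = e` is compatible with `ρ` on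
`H¹` (`hcompat`), `Ker(H¹ → lim_J)` is torsion (`hker`), and the translate inputs `hdesc`/`hrev`/`hfree` hold for `ρ`, then every
`ϑ ∈ ∞θ^{i₀}_env` has a positive power equal to a TORSION multiple of any given `θ ∈ θ^{i₀}_env`: `ϑ^N = τ · θ`, `IsOfFinOrder τ`.
Route: `ϑ` is (the transport of) an `N`-th root `x` of some `t ∈ θ(Π)`; `t` is `ρ`-invariant up to torsion (§1); `θ` comes from a
`ρ`-invariant `t₀` (`exists_theta_of_mem_toRecord_thetaEnv`); `t − t₀` is `2l`-torsion (file 1's `thetaIota_orbit_of_translates`).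
[cite: Mochizuki2012, Prop 2.2 (ii) p.66] -/
theorem exists_torsion_mul_eq_pow_of_mem_toRecord_inftyThetaEnv_of_translates
    (ρ : T.D.coh.H1 ⊤ ≃+ T.D.coh.H1 ⊤) (e : T.D.coh.lim ≃+ T.D.coh.lim)
    (hcompat : ∀ x, T.D.coh.toLim ⊤ (ρ x) = e (T.D.coh.toLim ⊤ x))
    (hker : ∀ y : T.D.coh.H1 ⊤, T.D.coh.toLim ⊤ y = 0 → IsOfFinAddOrder y)
    (τ : ℤ → T.D.coh.H1 ⊤)
    (hdesc : ∀ o ∈ T.D.orbit, ∃ (n : ℤ) (c : T.D.coh.H1 ⊤), 2 • c = 0 ∧ o = τ n + c)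
    (hrev : ∀ n : ℤ, IsOfFinAddOrder (ρ (τ n) - τ (-n)))
    (hfree : ∀ m n : ℤ, IsOfFinAddOrder (τ m - τ n) → m = n)
    {i₀ : Iota} (hi₀ : iota i₀ = e) {θ ϑ : Multiplicative T.cohEnv.lim}
    (hθ : θ ∈ (T.toRecord act κ iota).thetaEnv i₀) (hϑ : ϑ ∈ (T.toRecord act κ iota).inftyThetaEnv i₀) :
    ∃ (N : ℕ) (τ' : Multiplicative T.cohEnv.lim), 0 < N ∧ IsOfFinOrder τ' ∧ ϑ ^ N = τ' * θ := by
  obtain ⟨t₀, ht₀, hinv₀, hθeq⟩ := T.exists_theta_of_mem_toRecord_thetaEnv act κ iota hθ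
  rw [hi₀] at hinv₀
  have h1 := (T.mem_envSet_iff (T.thetaInftyIotaLim (iota i₀)) ϑ).mp hϑ
  rw [hi₀, T.mem_thetaInftyIotaLim_iff] at h1
  set x : T.D.coh.lim := T.transportLim.symm (Multiplicative.toAdd ϑ) with hxdef
  obtain ⟨N, hN, t, ht, hroot⟩ := (T.D.mem_thetaInfty_iff_exists_level x).mp h1.1
  -- `t` and `t₀` are `ρ`-invariant up to torsion, hence differ by `2l`-torsion
  have hιt : IsOfFinAddOrder (ρ t - t) :=
    T.D.isOfFinAddOrder_sub_of_root_of_invariant ρ e hcompat hker h1.2 hroot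
  have hιt₀ : IsOfFinAddOrder (ρ t₀ - t₀) := by
    rw [← hcompat, ← map_sub] at hinv₀
    exact T.D.isOfFinAddOrder_of_toLim hker hinv₀
  have horb : (2 * S.l) • (t - t₀) = 0 :=
    T.D.thetaIota_orbit_of_translates ρ τ hdesc hrev hfree t₀ ht₀ t ht hιt₀ hιt
  have htt₀ : IsOfFinAddOrder (T.D.coh.toLim ⊤ t - T.D.coh.toLim ⊤ t₀) := by
    rw [← map_sub]
    exact (T.D.coh.toLim ⊤).isOfFinAddOrder
      (isOfFinAddOrder_iff_nsmul_eq_zero.2 ⟨2 * S.l, Nat.mul_pos two_pos S.l_prime.pos, horb⟩)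
  have hNx : IsOfFinAddOrder (N • x - T.D.coh.toLim ⊤ t₀) := by
    have hsum := hroot.add htt₀
    rwa [sub_add_sub_cancel] at hsum
  refine ⟨N, Multiplicative.ofAdd (T.transportLim (N • x - T.D.coh.toLim ⊤ t₀)), hN, ?_, ?_⟩
  · exact isOfFinOrder_ofAdd_iff.mpr (T.transportLim.toAddMonoidHom.isOfFinAddOrder hNx)
  · apply Multiplicative.toAdd.injective
    rw [toAdd_pow, toAdd_mul, toAdd_ofAdd, hθeq, ← map_add, sub_add_cancel, map_nsmul, hxdef,
      AddEquiv.apply_symm_apply]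

/-- **IUTchII:Cor3.5(ii)** `∞`-level junction hypothesis `hroots` for the produced record and a GIVEN action: every generator
`ϑ ∈ ∞θ^{i₀}_env(M^Θ_*)` has a positive power in `M^×_TM · θ^ℕ` (`θ ∈ θ^{i₀}_env` fixed), given `M^μ_TM ⊆ M^×_TM` (`htors`),
`iota i₀ = e` compatible with `ρ`, `hker`, and the translate inputs for `ρ`. [cite: Mochizuki2012, Cor 3.5 (ii) p.95] -/
theorem hroots_toRecord_of_translates
    (ρ : T.D.coh.H1 ⊤ ≃+ T.D.coh.H1 ⊤) (e : T.D.coh.lim ≃+ T.D.coh.lim)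
    (hcompat : ∀ x, T.D.coh.toLim ⊤ (ρ x) = e (T.D.coh.toLim ⊤ x))
    (hker : ∀ y : T.D.coh.H1 ⊤, T.D.coh.toLim ⊤ y = 0 → IsOfFinAddOrder y)
    (τ : ℤ → T.D.coh.H1 ⊤)
    (hdesc : ∀ o ∈ T.D.orbit, ∃ (n : ℤ) (c : T.D.coh.H1 ⊤), 2 • c = 0 ∧ o = τ n + c)
    (hrev : ∀ n : ℤ, IsOfFinAddOrder (ρ (τ n) - τ (-n)))
    (hfree : ∀ m n : ℤ, IsOfFinAddOrder (τ m - τ n) → m = n)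
    {i₀ : Iota} (hi₀ : iota i₀ = e)
    (htors : ∀ u : (T.toRecord act κ iota).H, IsOfFinOrder u → u ∈ (T.toRecord act κ iota).units)
    {θ : (T.toRecord act κ iota).H} (hθ : θ ∈ (T.toRecord act κ iota).thetaEnv i₀) :
    ∀ ϑ ∈ (T.toRecord act κ iota).inftyThetaEnv i₀, ∃ N : ℕ, 0 < N ∧
      ϑ ^ N ∈ splitMonoid (T.toRecord act κ iota).units (Submonoid.powers θ) := by
  intro ϑ hϑ
  obtain ⟨N, τ', hN, hτ', h⟩ := T.exists_torsion_mul_eq_pow_of_mem_toRecord_inftyThetaEnv_of_translates act κ iota ρ e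
    hcompat hker τ hdesc hrev hfree hi₀ hθ hϑ
  exact ⟨N, hN, (mem_splitMonoid_iff _ _ _).mpr ⟨τ', htors τ' hτ', θ, Submonoid.mem_powers θ, h.symm⟩⟩

end ThetaEnvData

/-! ### §3. At the GENUINE `θ_env` data of `X̲̲_K` for the pair action `pairRhoLim C α β …` -/

namespace EtaleLevels

open Literature.AnabelianGeometry.EtaleTheta CohomologySystemOfContH1 EtaleThetaDataOfSetting TemperedThetaMonoids
  BadPrimeGaussianMonoids

variable {p : ℕ} [Fact p.Prime] {D : Literature.AnabelianGeometry.EtaleTheta.ThetaSetting p}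
  {E : D.EtaleThetaData} {l : ℕ} (C : E.DoubleUnderline l) (hC : D.Compat) (hS : D.Sec2Hyps)
  (hl : l.Prime) (hp2 : p ≠ 2) (hpl : p ≠ l) (hζ : ∃ ζ : D.K, IsPrimitiveRoot ζ (4 * l))
  (mods : ∀ M : ℕ+, D.CyclotomeMod l M)
  (f : contCocycles D.toTheta D.DeltaTheta C.GtpYdduu) (hf : f ∈ C.rootCocycles hC)
  (hmods : ∀ (M M' : ℕ+) (h : (M : ℕ) ∣ (M' : ℕ)) (x : D.lDeltaTheta l),
    MuN.red p M M' h ((mods M').red x) = (mods M).red x)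
  (h15 : Literature.AnabelianGeometry.EtaleTheta.ThetaSetting.Prop15iii E hC) (L : C.CuspLabels)
  (hZ : ∀ M : ℕ+, Nonempty (ModelCyclotomes.lDeltaQuot (C.rigidData (mods M) hC hS h15 L) ≃*
    Literature.IUT.HodgeTheaters.ZHat))
  (hcharY : EtaleThetaDataOfSetting.PiYddCharacteristic C)
  (hlim : Function.Bijective (rigidLimHom C hC hS hl hp2 hpl hζ mods f hf hmods h15 L hZ))
  [(EtaleThetaDataOfSetting.PiYdd C).Normal]
  {A : Type} [CommGroup A] [MulDistribMulAction (Pi C) A] [TopologicalSpace A] [RootableBy A ℕ]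
  (c : CyclotomeCoefficients (phi C) (D.lDeltaTheta l) A)
  (hA : ∀ b : A, IsOpen (MulAction.stabilizer (Pi C) b : Set (Pi C)))
  (hfi : ∀ b : A, (MulAction.stabilizer (Pi C) b).FiniteIndex)
  (O : Submonoid A)
  {Iota : Type}
  (iota : Iota → ((thetaEnvData C hC hS hl hp2 hpl hζ mods f hf hmods h15 L hZ hcharY hlim).D.coh.lim ≃+
    (thetaEnvData C hC hS hl hp2 hpl hζ mods f hf hmods h15 L hZ hcharY hlim).D.coh.lim))

/-- **`hroots` AT THE GENUINE RECORD for the pair action** ([IUTchII] Prop 1.4 p. 27 / Cor 3.5 (ii) p. 95): for the record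
`(thetaEnvData …).toRecord (h1LimConjMulAut …) (h1LimKummerOn c hA hfi O) iota` with `iota i₀ = pairRhoLim C α β …`, every
`ϑ ∈ ∞θ^{i₀}_env(𝕄_*)` has a positive power in `M^×_TM · θ^ℕ` — from (R1)(R2)(R3) of abc-iut-w4-d010's `prop22_ii'_model`, `hker`, and
`M^μ_TM ⊆ M^×_TM` DISCHARGED by abc-iut-w5-d192's `htors_toRecord_family` (bijective `c`, `μ ⊆ O` with inverses).
[cite: Mochizuki2012, Cor 3.5 (ii) p.95] -/
theorem hroots_toRecord_pairRhoLim (hc : Function.Bijective c.hom)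
    (hOtors : ∀ a : A, IsOfFinOrder a → a ∈ O ∧ a⁻¹ ∈ O)
    -- (R1) the pointed-inversion PAIR, reversing the `ℤ`-torsor
    (α : (Pi C) ≃ₜ* (Pi C)) (β : D.GtpTheta ≃ₜ* D.GtpTheta) (hφαβ : ∀ g, β (phi C g) = phi C (α g))
    (hAβ : ∀ a : D.GtpTheta, a ∈ D.lDeltaTheta l ↔ β a ∈ D.lDeltaTheta l)
    (hH : ∀ x, x ∈ PiYdd C ↔ α x ∈ PiYdd C)
    (γ ε : Pi C) (hγ : C.toLZ γ = Multiplicative.ofAdd 1) (hε₁ : (ε : D.PiTemp) ∈ D.GtpY)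
    (hε₂ : (ε : D.PiTemp) ∉ D.GtpYdd) (hαγ : C.toLZ (α γ) = Multiplicative.ofAdd (-1))
    -- (R2)(R3) [EtTh] Prop 1.4 at the class level
    (hsign : ∃ κ : ContH1 (phi C) (D.lDeltaTheta l) (PiYdd C ⊓ ⊤), κ ^ 2 = 1 ∧
      ContH1.conj (phi C) (D.lDeltaTheta l) ε (rootLiftClass C) = rootLiftClass C * κ)
    (hroot : ∃ τ₀ : Pi C, (τ₀ : D.PiTemp) ∈ D.GtpY ∧
      h1TopAut (phi C) (D.lDeltaTheta l) (PiYdd C) α β hφαβ (fun a ha => (hAβ a).mp ha) hH (rootLiftClass C) =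
        ContH1.conj (phi C) (D.lDeltaTheta l) τ₀ (rootLiftClass C))
    (hfree : ∀ m n : ℤ, IsOfFinAddOrder
      ((h1Top C).symm (Additive.ofMul (ContH1.conj (phi C) (D.lDeltaTheta l) (γ ^ m) (rootLiftClass C))) -
        (h1Top C).symm (Additive.ofMul (ContH1.conj (phi C) (D.lDeltaTheta l) (γ ^ n) (rootLiftClass C)))) →
      m = n)
    (hker : ∀ y : (coh C).H1 ⊤, (coh C).toLim ⊤ y = 0 → IsOfFinAddOrder y)
    {i₀ : Iota} (hi₀ : iota i₀ = pairRhoLim C α β hφαβ hAβ hH)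
    {θ : ((thetaEnvData C hC hS hl hp2 hpl hζ mods f hf hmods h15 L hZ hcharY hlim).toRecord
          (h1LimConjMulAut (phi C) (D.lDeltaTheta l) (PiYdd C))
          (h1LimKummerOn (phi C) (D.lDeltaTheta l) (PiYdd C) c hA hfi O) iota).H}
    (hθ : θ ∈ ((thetaEnvData C hC hS hl hp2 hpl hζ mods f hf hmods h15 L hZ hcharY hlim).toRecord
          (h1LimConjMulAut (phi C) (D.lDeltaTheta l) (PiYdd C))
          (h1LimKummerOn (phi C) (D.lDeltaTheta l) (PiYdd C) c hA hfi O) iota).thetaEnv i₀) :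
    ∀ ϑ ∈ ((thetaEnvData C hC hS hl hp2 hpl hζ mods f hf hmods h15 L hZ hcharY hlim).toRecord
          (h1LimConjMulAut (phi C) (D.lDeltaTheta l) (PiYdd C))
          (h1LimKummerOn (phi C) (D.lDeltaTheta l) (PiYdd C) c hA hfi O) iota).inftyThetaEnv i₀,
      ∃ N : ℕ, 0 < N ∧ ϑ ^ N ∈ splitMonoid ((thetaEnvData C hC hS hl hp2 hpl hζ mods f hf hmods h15 L hZ hcharY hlim).toRecord
          (h1LimConjMulAut (phi C) (D.lDeltaTheta l) (PiYdd C))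
          (h1LimKummerOn (phi C) (D.lDeltaTheta l) (PiYdd C) c hA hfi O) iota).units (Submonoid.powers θ) :=
  (thetaEnvData C hC hS hl hp2 hpl hζ mods f hf hmods h15 L hZ hcharY hlim).hroots_toRecord_of_translates
    (h1LimConjMulAut (phi C) (D.lDeltaTheta l) (PiYdd C)) (h1LimKummerOn (phi C) (D.lDeltaTheta l) (PiYdd C) c hA hfi O) iota
    (pairRho C α β hφαβ hAβ hH) (pairRhoLim C α β hφαβ hAβ hH) (toLim_pairRho C α β hφαβ hAβ hH) hker
    (fun n => (h1Top C).symm (Additive.ofMul (ContH1.conj (phi C) (D.lDeltaTheta l) (γ ^ n) (rootLiftClass C))))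
    (orbitOne_desc_of_sign C hC hS γ ε hγ hε₁ hε₂ hsign)
    (hrev_of_transport C hS γ ε hγ hε₁ hε₂ hsign α β hφαβ (fun a ha => (hAβ a).mp ha) hH hαγ
      (hιsign_of_hroot C hS α β hφαβ (fun a ha => (hAβ a).mp ha) hH ε hε₁ hε₂ hsign hroot)
      (pairRho C α β hφαβ hAβ hH) (pairRho_h1Top_symm C α β hφαβ hAβ hH))
    hfree hi₀
    (htors_toRecord_family C hC hS hl hp2 hpl hζ mods f hf hmods h15 L hZ hcharY hlim iota c hA hfi O hc hOtors) hθ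

section InftyCapstone

variable (hO : ∀ (σ : Pi C) (b : A), b ∈ O → σ • b ∈ O)
  {Lbl : Type*} {P₀ : TopGroup.{0}} (φ₀ : P₀ →* D.GtpTheta) (s : Lbl → (P₀ →* Pi C))
  (hι : ∀ t, Continuous ((MonoidHom.id (Pi C)).comp (s t)))
  (hN : ∀ t, (⊤ : Subgroup P₀).map ((MonoidHom.id (Pi C)).comp (s t)) ≤ PiYdd C)
  (hφ : ∀ t, (phi C).comp ((MonoidHom.id (Pi C)).comp (s t)) = φ₀)

include hO in
/-- **IUTchII:Cor3.5(ii)** (kurims p.95) at `∞Ψ^ι_env(𝕄_*)`, FAITHFUL (torsion) form, **AT THE GENUINE `θ_env` DATA with print's root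
condition `hroots` DISCHARGED** for any inversion family whose `i₀`-th member is the pair action `pairRhoLim C α β …`: for every
`θ ∈ θ^{i₀}_env(𝕄_*)` and `x ∈ ∞Ψ^{i₀}_env = M^×_TM · ⟨∞θ^{i₀}_env⟩`, the product restriction of `s_{t₀}(g)·x` is the diagonal
translate of the product restriction of `x` up to a family of `n`-torsion classes (`n > 0`) — abc-iut-w4-d004 gen 3's
`pi_restriction_inftyThetaMonoid_upToTorsion_toRecord_of_mem_thetaEnv` (p434744) fed with `hroots_toRecord_pairRhoLim`. Inputs:
evaluation-sections data (`s`, `q`/`w`/`hsec`), model data (`c` bijective, `μ ⊆ O`, `O` `Π`-stable), (R1)(R2)(R3), `hker`.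
[cite: Mochizuki2012, Cor 3.5 (ii) p.95] -/
theorem pi_restriction_inftyThetaMonoid_upToTorsion_toRecord_pairRhoLim (hc : Function.Bijective c.hom)
    (hOtors : ∀ a : A, IsOfFinOrder a → a ∈ O ∧ a⁻¹ ∈ O)
    -- (R1) the pointed-inversion PAIR, reversing the `ℤ`-torsor
    (α : (Pi C) ≃ₜ* (Pi C)) (β : D.GtpTheta ≃ₜ* D.GtpTheta) (hφαβ : ∀ g, β (phi C g) = phi C (α g))
    (hAβ : ∀ a : D.GtpTheta, a ∈ D.lDeltaTheta l ↔ β a ∈ D.lDeltaTheta l)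
    (hH : ∀ x, x ∈ PiYdd C ↔ α x ∈ PiYdd C)
    (γ ε : Pi C) (hγ : C.toLZ γ = Multiplicative.ofAdd 1) (hε₁ : (ε : D.PiTemp) ∈ D.GtpY)
    (hε₂ : (ε : D.PiTemp) ∉ D.GtpYdd) (hαγ : C.toLZ (α γ) = Multiplicative.ofAdd (-1))
    -- (R2)(R3) [EtTh] Prop 1.4 at the class level
    (hsign : ∃ κ : ContH1 (phi C) (D.lDeltaTheta l) (PiYdd C ⊓ ⊤), κ ^ 2 = 1 ∧
      ContH1.conj (phi C) (D.lDeltaTheta l) ε (rootLiftClass C) = rootLiftClass C * κ)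
    (hroot : ∃ τ₀ : Pi C, (τ₀ : D.PiTemp) ∈ D.GtpY ∧
      h1TopAut (phi C) (D.lDeltaTheta l) (PiYdd C) α β hφαβ (fun a ha => (hAβ a).mp ha) hH (rootLiftClass C) =
        ContH1.conj (phi C) (D.lDeltaTheta l) τ₀ (rootLiftClass C))
    (hfree : ∀ m n : ℤ, IsOfFinAddOrder
      ((h1Top C).symm (Additive.ofMul (ContH1.conj (phi C) (D.lDeltaTheta l) (γ ^ m) (rootLiftClass C))) -
        (h1Top C).symm (Additive.ofMul (ContH1.conj (phi C) (D.lDeltaTheta l) (γ ^ n) (rootLiftClass C)))) →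
      m = n)
    (hker : ∀ y : (coh C).H1 ⊤, (coh C).toLim ⊤ y = 0 → IsOfFinAddOrder y)
    {K : Type*} [Group K] (q : Pi C →* K) (hq : ∀ x : Pi C, q x = 1 → ∀ a ∈ O, x • a = a) (w : P₀ →* K)
    (hsec : ∀ t g, q (s t g) = w g) {i₀ : Iota} (hi₀ : iota i₀ = pairRhoLim C α β hφαβ hAβ hH)
    {θ : ((thetaEnvData C hC hS hl hp2 hpl hζ mods f hf hmods h15 L hZ hcharY hlim).toRecord
        (h1LimConjMulAut (phi C) (D.lDeltaTheta l) (PiYdd C)) (h1LimKummerOn (phi C) (D.lDeltaTheta l) (PiYdd C) c hA hfi O)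
        iota).H}
    (hθ : θ ∈ ((thetaEnvData C hC hS hl hp2 hpl hζ mods f hf hmods h15 L hZ hcharY hlim).toRecord
        (h1LimConjMulAut (phi C) (D.lDeltaTheta l) (PiYdd C)) (h1LimKummerOn (phi C) (D.lDeltaTheta l) (PiYdd C) c hA hfi O)
        iota).thetaEnv i₀)
    (R : Lbl → (((thetaEnvData C hC hS hl hp2 hpl hζ mods f hf hmods h15 L hZ hcharY hlim).toRecord
        (h1LimConjMulAut (phi C) (D.lDeltaTheta l) (PiYdd C)) (h1LimKummerOn (phi C) (D.lDeltaTheta l) (PiYdd C) c hA hfi O)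
        iota).H →*
      Multiplicative (h1Lim φ₀ (D.lDeltaTheta l) (⊤ : Subgroup P₀) ⊥)))
    (hR : ∀ t y, Multiplicative.toAdd (R t y) =
      h1LimCongr (D.lDeltaTheta l) ⊤ (hφ t) ⊥
        (h1LimComap (phi C) (D.lDeltaTheta l) ((MonoidHom.id (Pi C)).comp (s t)) (hι t) (hN t)
          (AddEquiv.additiveMultiplicative (h1Lim (phi C) (D.lDeltaTheta l) (PiYdd C) ⊥) (Additive.ofMul y))))
    {x : ((thetaEnvData C hC hS hl hp2 hpl hζ mods f hf hmods h15 L hZ hcharY hlim).toRecord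
        (h1LimConjMulAut (phi C) (D.lDeltaTheta l) (PiYdd C)) (h1LimKummerOn (phi C) (D.lDeltaTheta l) (PiYdd C) c hA hfi O)
        iota).H}
    (hx : x ∈ ((thetaEnvData C hC hS hl hp2 hpl hζ mods f hf hmods h15 L hZ hcharY hlim).toRecord
        (h1LimConjMulAut (phi C) (D.lDeltaTheta l) (PiYdd C)) (h1LimKummerOn (phi C) (D.lDeltaTheta l) (PiYdd C) c hA hfi O)
        iota).inftyThetaMonoid i₀)
    (t₀ : Lbl) (g : P₀) :
    ∃ (n : ℕ) (u : Lbl → ((thetaEnvData C hC hS hl hp2 hpl hζ mods f hf hmods h15 L hZ hcharY hlim).toRecord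
        (h1LimConjMulAut (phi C) (D.lDeltaTheta l) (PiYdd C)) (h1LimKummerOn (phi C) (D.lDeltaTheta l) (PiYdd C) c hA hfi O)
        iota).H),
      0 < n ∧ (∀ t, u t ^ n = 1) ∧
      MonoidHom.pi R
          (((thetaEnvData C hC hS hl hp2 hpl hζ mods f hf hmods h15 L hZ hcharY hlim).toRecord
        (h1LimConjMulAut (phi C) (D.lDeltaTheta l) (PiYdd C)) (h1LimKummerOn (phi C) (D.lDeltaTheta l) (PiYdd C) c hA hfi O)
        iota).conj (s t₀ g) x) =
        (fun t => R t (u t)) * piIso Lbl (h1LimConjMulAut φ₀ (D.lDeltaTheta l) ⊤ g) (MonoidHom.pi R x) :=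
  pi_restriction_inftyThetaMonoid_upToTorsion_ofKummerHom_labelwise
    ((thetaEnvData C hC hS hl hp2 hpl hζ mods f hf hmods h15 L hZ hcharY hlim).toRecord
        (h1LimConjMulAut (phi C) (D.lDeltaTheta l) (PiYdd C)) (h1LimKummerOn (phi C) (D.lDeltaTheta l) (PiYdd C) c hA hfi O)
        iota)
    (MulDistribMulAction.toMulAut (Pi C) A) O (fun σ b hb => hO σ b hb)
    (h1LimKummerOn (phi C) (D.lDeltaTheta l) (PiYdd C) c hA hfi O) (phi C) φ₀ (D.lDeltaTheta l) (PiYdd C)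
    (MonoidHom.id (Pi C)) (AddEquiv.additiveMultiplicative (h1Lim (phi C) (D.lDeltaTheta l) (PiYdd C) ⊥)) s hι hN hφ
    (ThetaEnvData.toRecord_constantMonoid _ _ _ _)
    (fun (σ : Pi C) m => h1LimKummerOn_smul (phi C) (D.lDeltaTheta l) (PiYdd C) c hA hfi O σ m
      ⟨σ • (m : A), hO σ m m.2⟩ rfl)
    q (fun x hx a ha => hq x hx a ha) w hsec
    (fun _ _ => rfl) i₀ θ
    (toRecord_topClass (thetaEnvData C hC hS hl hp2 hpl hζ mods f hf hmods h15 L hZ hcharY hlim)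
      (CohomologySystemOfContH1.h1LimConjMulAut (phi C) (D.lDeltaTheta l) (PiYdd C))
      (h1LimKummerOn (phi C) (D.lDeltaTheta l) (PiYdd C) c hA hfi O)
      iota
      (phi C) (D.lDeltaTheta l) (PiYdd C)
      (AddEquiv.additiveMultiplicative (h1Lim (phi C) (D.lDeltaTheta l) (PiYdd C) ⊥)) (fun y _ => ⟨y, rfl⟩) hθ)
    (hroots_toRecord_pairRhoLim C hC hS hl hp2 hpl hζ mods f hf hmods h15 L hZ hcharY hlim c hA hfi O iota hc hOtors α β hφαβ
      hAβ hH γ ε hγ hε₁ hε₂ hαγ hsign hroot hfree hker hi₀ hθ)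
    R hR hx t₀ g

end InftyCapstone

end EtaleLevels

end Literature.IUT.HodgeArakelov

end
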